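import Summits.HodgeConjecture.HodgeConjecture.Theorems.Q8SymplecticPowersBlockExtension
import Summits.HodgeConjecture.HodgeConjecture.Theorems.Q8SymplecticPowersEndomorphismAlgebra
import Summits.HodgeConjecture.HodgeConjecture.Theorems.Q8SymplecticPowersDeckIsometry
import Literature.AlgebraicGeometry.Motives.HodgeStructureHodgeVectorBlockMorphisms
import Literature.AlgebraicGeometry.HodgeTheory.BettiUniverseTracePairing
import HarnessLib

/-!
# Route `Q8SymplecticPowers`, programme K2Q — brick S1: the END-BOUND `dim_ℚ End_HS(T(X)) ≤ 4` and
# `dim_ℚ End_HS(H²(X)) ≤ ρ(X)² + 4` under the route's deck and `Comm` clauses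

Support file for crux K2Q `PowersHodgeOfQuaternionCommutators` (stmt-HodgeConjecture-24191; `--supports … --as helper`;
nothing here closes an item).  Prover seat `hodge-nonav-20241-p1` (g20).

For a smooth projective surface `X` with deck data `τ, j` as in the route (`τ^{*4} = 1`, `j^{*2} = τ^{*2}`,
`j^*τ^* = τ^{*3}j^*`, no `τ^{*2}`-invariant `(2,0)`-forms, `H^{2,0} ≠ 0`) and the route's `Comm` clause (commutators of the
typed quaternionic-unitary centraliser `Uni` lie in the Hodge group):

* **`hom_transcendental_eq_quaternion`** — every endomorphism of Hodge structures of the transcendental part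
  `T = Hdg¹(H²X)^{⊥ψ}` is `α + β τ^*|_T + γ j^*|_T + δ τ^*j^*|_T` with `α, …, δ ∈ ℚ`: E-Q1 (`hom_apply_commutator_eq`: `φ`
  commutes with the commutators of the `ℚ`-points of the quaternionic-unitary centraliser of `(T, tr∘cup|_T, τ^*|_T, j^*|_T)`)
  + E-Q2b (`exists_eq_quaternion_of_commute_commutators`); the form `tr∘cup|_T` is nondegenerate by Poincaré duality and
  C-Q4 (`Hdg¹ ⊥_{tr∘cup} T`), `τ^*, j^*` are isometries (C-Q2) and quaternionic on `T` (C-Q3).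
* **`finrank_hom_transcendental_le_four`** — `dim_ℚ End_HS(T) ≤ 4`;
* **`finrank_end_hodge_le`** — `dim_ℚ End_HS(H²(X)) ≤ ρ² + 4` (`Polarization.finrank_hom_eq`).

This is the S1 half of the square case `stub_squareQ` via the tree criterion
`BettiUniverse.hodgeConjectureFor_tensor_surfaces_of_linearIndependent_corrAction` (memo PROGRAMME-K2Q); the S2 half
(`ρ² + 4` algebraic self-correspondences with independent actions: divisor products and the graphs of `1, τ, j, τj`) is not
in this file.  HONEST FRAMING: axioms standard; item 24191 OPEN; nothing here says HC ∕ HC_CM ∕ HC_AV is proved.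

## References

* C. Voisin, *Hodge Theory and Complex Algebraic Geometry I* (2002), §7.3.1 Lemma 7.26, §11.3.3. [cite: VoisinHodgeI2002]
* D. Huybrechts, *Lectures on K3 surfaces* (2016), Ch. 3 Cor. 3.4, Thm. 3.3.9. [cite: Huybrechts2016K3]
* R. Goodman, N. Wallach, *Symmetry, Representations, and Invariants*, GTM 255, §4.2. [cite: GoodmanWallachGTM255]
-/

set_option linter.dupNamespace false

noncomputable section

open scoped TensorProduct
open CategoryTheory
open Literature.AlgebraicGeometry.Motives Literature.AlgebraicGeometry.HodgeTheory
open Literature.AlgebraicGeometry.HodgeTheory.BettiUniverse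
open Literature.AlgebraicGeometry.Motives.HodgeStructure
open Literature.AlgebraicTopology.SingularHomology
open Summit.HodgeConjecture.HodgeConjecture.Theorems.Q8SymplecticPowersTranscendentalPart
open Summit.HodgeConjecture.HodgeConjecture.Theorems.Q8SymplecticPowersTranscendentalOrthogonal
open Summit.HodgeConjecture.HodgeConjecture.Theorems.Q8SymplecticPowersBlockExtension
open Summit.HodgeConjecture.HodgeConjecture.Theorems.Q8SymplecticPowersDeckIsometry
open Summit.HodgeConjecture.HodgeConjecture.Theorems.Q8SymplecticPowersEndomorphismAlgebra

namespace Summit.HodgeConjecture.HodgeConjecture.Theorems.Q8SymplecticPowersEndBound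

variable {X : SchemeOver ℂ}

/-- **`End_HS(T(X)) ⊆ ℚ⟨1, τ^*, j^*, τ^*j^*⟩|_T`** under the route's deck and `Comm` clauses: every endomorphism of Hodge
structures of the transcendental part `T = Hdg¹(H²X)^{⊥ψ}` is a rational quaternion in `τ^*|_T`, `j^*|_T`.
[cite: Huybrechts2016K3, Thm. 3.3.9 (proof)] [cite: GoodmanWallachGTM255, §4.2] [cite: VoisinHodgeI2002, §7.3.1 Lemma 7.26] -/
theorem hom_transcendental_eq_quaternion (hX : IsSmoothProjective 2 X) (τ j : X ⟶ X) (h4 : pull τ 2 ^ 4 = 1)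
    (hj : pull j 2 ^ 2 = pull τ 2 ^ 2) (hrel : pull j 2 * pull τ 2 = pull τ 2 ^ 3 * pull j 2)
    (h20 : Module.finrank ℂ ↥(Module.End.eigenspace ((pull τ 2 ^ 2).baseChange ℂ) 1 ⊓
      (hodge exists_isReal_hodgeModel_holds hX 2).piece 2 0) = 0)
    (hpos : 0 < Module.finrank ℂ ↥(Module.End.eigenspace ((pull τ 2 ^ 2).baseChange ℂ) (-1) ⊓
      (hodge exists_isReal_hodgeModel_holds hX 2).piece 2 0))
    (hComm : haveI := finite hX 2; haveI : HodgeTensorFacts.{0, 0} := hodgeTensorFacts_holds;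
      ∀ g h : bettiCohomology X 2 ≃ₗ[ℚ] bettiCohomology X 2,
        ((∀ x, g (pull τ 2 x) = pull τ 2 (g x)) ∧ (∀ x, g (pull j 2 x) = pull j 2 (g x)) ∧
          (∀ x y, tr hX (2 + 2) (cup X 2 2 (g x) (g y)) = tr hX (2 + 2) (cup X 2 2 x y)) ∧
          ∀ x ∈ (hodge exists_isReal_hodgeModel_holds hX 2).hodgeClasses 1, g x = x) →
        ((∀ x, h (pull τ 2 x) = pull τ 2 (h x)) ∧ (∀ x, h (pull j 2 x) = pull j 2 (h x)) ∧
          (∀ x y, tr hX (2 + 2) (cup X 2 2 (h x) (h y)) = tr hX (2 + 2) (cup X 2 2 x y)) ∧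
          ∀ x ∈ (hodge exists_isReal_hodgeModel_holds hX 2).hodgeClasses 1, h x = x) →
        g * h * g⁻¹ * h⁻¹ ∈ (hodge exists_isReal_hodgeModel_holds hX 2).hodgeGroup)
    (ψ : Polarization (hodge exists_isReal_hodgeModel_holds hX 2))
    {T : SubHodgeStructure (hodge exists_isReal_hodgeModel_holds hX 2)}
    (hT : T.toSubmodule = ψ.form.orthogonal ((hodge exists_isReal_hodgeModel_holds hX 2).hodgeClasses 1))
    (hτT : ∀ x ∈ T.toSubmodule, pull τ 2 x ∈ T.toSubmodule) (hjT : ∀ x ∈ T.toSubmodule, pull j 2 x ∈ T.toSubmodule)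
    (φ : Hom T.toHodgeStructure T.toHodgeStructure) :
    ∃ α β γ δ : ℚ, φ.toLinearMap = α • 1 + β • (pull τ 2).restrict hτT + γ • (pull j 2).restrict hjT +
      δ • ((pull τ 2).restrict hτT * (pull j 2).restrict hjT) := by
  haveI := finite hX 2
  have hmem : ∀ t : T.toSubmodule, (t : bettiCohomology X 2) ∈
      ψ.form.orthogonal ((hodge exists_isReal_hodgeModel_holds hX 2).hodgeClasses 1) := fun t => hT.le t.2
  have h11 : (1 : ℤ) + 1 = ((2 : ℕ) : ℤ) := by norm_num
  have hc : IsCompl ((hodge exists_isReal_hodgeModel_holds hX 2).hodgeClasses 1) T.toSubmodule := by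
    rw [hT]; exact ψ.isCompl_hodgeClasses_orthogonal h11
  -- the data `(W, Q, a, b)` = `(T, tr∘cup|_T, τ^*|_T, j^*|_T)`
  let Q : LinearMap.BilinForm ℚ T.toSubmodule :=
    LinearMap.BilinForm.restrict ((cup X 2 2).compr₂ (tr hX (2 + 2))) T.toSubmodule
  have hQ : ∀ x y : T.toSubmodule, Q x y = tr hX (2 + 2) (cup X 2 2 (x : bettiCohomology X 2) y) := fun x y => rfl
  have hQsV : ∀ x y : bettiCohomology X 2, tr hX (2 + 2) (cup X 2 2 x y) = tr hX (2 + 2) (cup X 2 2 y x) := fun x y => by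
    have h := bettiCup_gradedComm (cupProduct_gradedComm_holds ℚ (ComplexPoints X)) (rfl : 2 + 2 = 2 + 2) rfl x y
    have h1 : ((-1 : ℚ) ^ (2 * 2)) = 1 := by norm_num
    rw [h1, one_smul] at h
    exact congrArg _ h
  have hQs : ∀ x y, Q x y = Q y x := fun x y => by rw [hQ, hQ, hQsV]
  have hQn : Q.Nondegenerate := by
    have hsep : ∀ x : T.toSubmodule, (∀ y : T.toSubmodule, Q x y = 0) → x = 0 := by
      intro x hx
      have hall : ∀ v : bettiCohomology X 2, tr hX (2 + 2) (cup X 2 2 (x : bettiCohomology X 2) v) = 0 := by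
        intro v
        obtain ⟨n, t, rfl⟩ := exists_eq_add hc v
        rw [map_add, map_add, tr_cup_eq_zero_of_mem_orthogonal_hodgeClasses hX ψ (hmem x) n.2, zero_add, ← hQ, hx t]
      have h0 : (x : bettiCohomology X 2) = 0 :=
        (nondegenerate_tr_cup hX).1 (x : bettiCohomology X 2) fun v => by
          rw [LinearMap.compr₂_apply]; exact hall v
      exact Subtype.ext h0
    refine ⟨fun x hx => hsep x fun y => hx y, fun y hy => hsep y fun x => ?_⟩
    rw [hQs]; exact hy x
  let a : T.toSubmodule →ₗ[ℚ] T.toSubmodule := (pull τ 2).restrict hτT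
  let b : T.toSubmodule →ₗ[ℚ] T.toSubmodule := (pull j 2).restrict hjT
  obtain ⟨hτ2, hj2, hτj⟩ := quaternion_relations_on_transcendental hX ψ τ j h4 hj hrel h20
  have haa : ∀ x, a (a x) = -x := fun x => Subtype.ext (by
    simp only [a, LinearMap.restrict_apply, Submodule.coe_neg]; exact hτ2 _ (hmem x))
  have hbb : ∀ x, b (b x) = -x := fun x => Subtype.ext (by
    simp only [b, LinearMap.restrict_apply, Submodule.coe_neg]; exact hj2 _ (hmem x))
  have hab : ∀ x, a (b x) = -b (a x) := fun x => Subtype.ext (by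
    simp only [a, b, LinearMap.restrict_apply, Submodule.coe_neg]; exact hτj _ (hmem x))
  have hpg : (hodge exists_isReal_hodgeModel_holds hX 2).piece 2 0 ≠ ⊥ := by
    intro hbot
    rw [hbot, inf_bot_eq, finrank_bot] at hpos
    exact lt_irrefl _ hpos
  have hj4 : pull j 2 ^ 4 = 1 := by rw [show (4 : ℕ) = 2 * 2 from rfl, pow_mul, hj, ← pow_mul]; exact h4
  have haQ : ∀ x y, Q (a x) (a y) = Q x y := fun x y => by
    simp only [hQ, a, LinearMap.restrict_apply]
    exact tr_cup_pull_pull_of_pull_pow_eq_one hX τ (by norm_num : 0 < 4) h4 hpg _ _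
  have hbQ : ∀ x y, Q (b x) (b y) = Q x y := fun x y => by
    simp only [hQ, b, LinearMap.restrict_apply]
    exact tr_cup_pull_pull_of_pull_pow_eq_one hX j (by norm_num : 0 < 4) hj4 hpg _ _
  -- `φ` commutes with the commutators of the rational points of the quaternionic-unitary centraliser of `T` (E-Q1)
  have hφ : ∀ g h : T.toSubmodule ≃ₗ[ℚ] T.toSubmodule, (∀ x, g (a x) = a (g x)) → (∀ x, g (b x) = b (g x)) →
      (∀ x y, Q (g x) (g y) = Q x y) → (∀ x, h (a x) = a (h x)) → (∀ x, h (b x) = b (h x)) →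
      (∀ x y, Q (h x) (h y) = Q x y) →
      ∀ x, φ.toLinearMap ((g * h * g⁻¹ * h⁻¹) x) = (g * h * g⁻¹ * h⁻¹) (φ.toLinearMap x) := by
    intro g h hga hgb hgQ hha hhb hhQ x
    refine hom_apply_commutator_eq hX ψ τ j hComm hT φ g h ?_ ?_ (fun x y => hgQ x y) ?_ ?_ (fun x y => hhQ x y) x
    · intro x; exact congrArg Subtype.val (hga x)
    · intro x; exact congrArg Subtype.val (hgb x)
    · intro x; exact congrArg Subtype.val (hha x)
    · intro x; exact congrArg Subtype.val (hhb x)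
  exact exists_eq_quaternion_of_commute_commutators Q hQs hQn a b haa hbb hab haQ hbQ φ.toLinearMap hφ

/-- **END-BOUND: `dim_ℚ End_HS(T(X)) ≤ 4`** under the route's deck and `Comm` clauses (the injection
`End_HS(T) ↪ End_ℚ(T)`, `φ ↦ φ`, lands in the span of `1, τ^*|_T, j^*|_T, τ^*j^*|_T`).
[cite: Huybrechts2016K3, Thm. 3.3.9 (proof)] [cite: GoodmanWallachGTM255, §4.2] -/
theorem finrank_hom_transcendental_le_four (hX : IsSmoothProjective 2 X) (τ j : X ⟶ X) (h4 : pull τ 2 ^ 4 = 1)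
    (hj : pull j 2 ^ 2 = pull τ 2 ^ 2) (hrel : pull j 2 * pull τ 2 = pull τ 2 ^ 3 * pull j 2)
    (h20 : Module.finrank ℂ ↥(Module.End.eigenspace ((pull τ 2 ^ 2).baseChange ℂ) 1 ⊓
      (hodge exists_isReal_hodgeModel_holds hX 2).piece 2 0) = 0)
    (hpos : 0 < Module.finrank ℂ ↥(Module.End.eigenspace ((pull τ 2 ^ 2).baseChange ℂ) (-1) ⊓
      (hodge exists_isReal_hodgeModel_holds hX 2).piece 2 0))
    (hComm : haveI := finite hX 2; haveI : HodgeTensorFacts.{0, 0} := hodgeTensorFacts_holds;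
      ∀ g h : bettiCohomology X 2 ≃ₗ[ℚ] bettiCohomology X 2,
        ((∀ x, g (pull τ 2 x) = pull τ 2 (g x)) ∧ (∀ x, g (pull j 2 x) = pull j 2 (g x)) ∧
          (∀ x y, tr hX (2 + 2) (cup X 2 2 (g x) (g y)) = tr hX (2 + 2) (cup X 2 2 x y)) ∧
          ∀ x ∈ (hodge exists_isReal_hodgeModel_holds hX 2).hodgeClasses 1, g x = x) →
        ((∀ x, h (pull τ 2 x) = pull τ 2 (h x)) ∧ (∀ x, h (pull j 2 x) = pull j 2 (h x)) ∧
          (∀ x y, tr hX (2 + 2) (cup X 2 2 (h x) (h y)) = tr hX (2 + 2) (cup X 2 2 x y)) ∧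
          ∀ x ∈ (hodge exists_isReal_hodgeModel_holds hX 2).hodgeClasses 1, h x = x) →
        g * h * g⁻¹ * h⁻¹ ∈ (hodge exists_isReal_hodgeModel_holds hX 2).hodgeGroup)
    (ψ : Polarization (hodge exists_isReal_hodgeModel_holds hX 2))
    {T : SubHodgeStructure (hodge exists_isReal_hodgeModel_holds hX 2)}
    (hT : T.toSubmodule = ψ.form.orthogonal ((hodge exists_isReal_hodgeModel_holds hX 2).hodgeClasses 1)) :
    Module.finrank ℚ (Hom T.toHodgeStructure T.toHodgeStructure) ≤ 4 := by
  classical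
  haveI := finite hX 2
  have hτT : ∀ x ∈ T.toSubmodule, pull τ 2 x ∈ T.toSubmodule := fun x hx =>
    hT.ge (pull_mem_transcendental hX ψ τ (hT.le hx))
  have hjT : ∀ x ∈ T.toSubmodule, pull j 2 x ∈ T.toSubmodule := fun x hx =>
    hT.ge (pull_mem_transcendental hX ψ j (hT.le hx))
  let a : T.toSubmodule →ₗ[ℚ] T.toSubmodule := (pull τ 2).restrict hτT
  let b : T.toSubmodule →ₗ[ℚ] T.toSubmodule := (pull j 2).restrict hjT
  -- the injection `End_HS(T) ↪ End_ℚ(T)` lands in the span of `1, a, b, ab`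
  let Θ : Hom T.toHodgeStructure T.toHodgeStructure →ₗ[ℚ] (T.toSubmodule →ₗ[ℚ] T.toSubmodule) :=
    { toFun := Hom.toLinearMap, map_add' := fun _ _ => rfl, map_smul' := fun _ _ => rfl }
  have hΘ : Function.Injective Θ := fun φ φ' h => Hom.toLinearMap_injective h
  let s : Finset (T.toSubmodule →ₗ[ℚ] T.toSubmodule) := {1, a, b, a * b}
  have hrange : LinearMap.range Θ ≤ Submodule.span ℚ (s : Set (T.toSubmodule →ₗ[ℚ] T.toSubmodule)) := by
    rintro _ ⟨φ, rfl⟩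
    obtain ⟨α, β, γ, δ, hφ⟩ := hom_transcendental_eq_quaternion hX τ j h4 hj hrel h20 hpos hComm ψ hT hτT hjT φ
    change φ.toLinearMap ∈ _
    rw [hφ]
    refine Submodule.add_mem _ (Submodule.add_mem _ (Submodule.add_mem _ (Submodule.smul_mem _ _ ?_)
      (Submodule.smul_mem _ _ ?_)) (Submodule.smul_mem _ _ ?_)) (Submodule.smul_mem _ _ ?_) <;>
      refine Submodule.subset_span ?_ <;> simp [s, a, b]
  calc Module.finrank ℚ (Hom T.toHodgeStructure T.toHodgeStructure)
      = Module.finrank ℚ (LinearMap.range Θ) := (LinearMap.finrank_range_of_inj hΘ).symm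
    _ ≤ Module.finrank ℚ (Submodule.span ℚ (s : Set (T.toSubmodule →ₗ[ℚ] T.toSubmodule))) :=
        Submodule.finrank_mono hrange
    _ ≤ s.card := finrank_span_finset_le_card s
    _ ≤ 4 := Finset.card_le_four

/-- **END-BOUND for `H²`: `dim_ℚ End_HS(H²(X)) ≤ ρ(X)² + 4`** under the route's deck and `Comm` clauses
(`End_HS(H²) = End(Hdg¹) × End_HS(T)`, `Polarization.finrank_hom_eq`). [cite: VoisinHodgeI2002, §7.3.1 Lemma 7.26 and §11.3.3]
[cite: Huybrechts2016K3, Thm. 3.3.9 (proof)] -/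
theorem finrank_end_hodge_le (hX : IsSmoothProjective 2 X) (τ j : X ⟶ X) (h4 : pull τ 2 ^ 4 = 1)
    (hj : pull j 2 ^ 2 = pull τ 2 ^ 2) (hrel : pull j 2 * pull τ 2 = pull τ 2 ^ 3 * pull j 2)
    (h20 : Module.finrank ℂ ↥(Module.End.eigenspace ((pull τ 2 ^ 2).baseChange ℂ) 1 ⊓
      (hodge exists_isReal_hodgeModel_holds hX 2).piece 2 0) = 0)
    (hpos : 0 < Module.finrank ℂ ↥(Module.End.eigenspace ((pull τ 2 ^ 2).baseChange ℂ) (-1) ⊓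
      (hodge exists_isReal_hodgeModel_holds hX 2).piece 2 0))
    (hComm : haveI := finite hX 2; haveI : HodgeTensorFacts.{0, 0} := hodgeTensorFacts_holds;
      ∀ g h : bettiCohomology X 2 ≃ₗ[ℚ] bettiCohomology X 2,
        ((∀ x, g (pull τ 2 x) = pull τ 2 (g x)) ∧ (∀ x, g (pull j 2 x) = pull j 2 (g x)) ∧
          (∀ x y, tr hX (2 + 2) (cup X 2 2 (g x) (g y)) = tr hX (2 + 2) (cup X 2 2 x y)) ∧
          ∀ x ∈ (hodge exists_isReal_hodgeModel_holds hX 2).hodgeClasses 1, g x = x) →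
        ((∀ x, h (pull τ 2 x) = pull τ 2 (h x)) ∧ (∀ x, h (pull j 2 x) = pull j 2 (h x)) ∧
          (∀ x y, tr hX (2 + 2) (cup X 2 2 (h x) (h y)) = tr hX (2 + 2) (cup X 2 2 x y)) ∧
          ∀ x ∈ (hodge exists_isReal_hodgeModel_holds hX 2).hodgeClasses 1, h x = x) →
        g * h * g⁻¹ * h⁻¹ ∈ (hodge exists_isReal_hodgeModel_holds hX 2).hodgeGroup) :
    Module.finrank ℚ (Hom (hodge exists_isReal_hodgeModel_holds hX 2) (hodge exists_isReal_hodgeModel_holds hX 2)) ≤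
      Module.finrank ℚ ((hodge exists_isReal_hodgeModel_holds hX 2).hodgeClasses 1) ^ 2 + 4 := by
  haveI := finite hX 2
  obtain ⟨ψ⟩ := hodge_isPolarizable exists_isReal_hodgeModel_holds hX 2
  have h11 : (1 : ℤ) + 1 = ((2 : ℕ) : ℤ) := by norm_num
  obtain ⟨T, hT⟩ := ψ.exists_subHodgeStructure_eq_orthogonal_hodgeClasses h11
  rw [ψ.finrank_hom_eq ψ h11 hT hT, sq]
  exact Nat.add_le_add_left (finrank_hom_transcendental_le_four hX τ j h4 hj hrel h20 hpos hComm ψ hT) _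

end Summit.HodgeConjecture.HodgeConjecture.Theorems.Q8SymplecticPowersEndBound

end
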